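import Mathlib.MeasureTheory.Integral.IntervalIntegral.Basic
import Mathlib.Order.LiminfLimsup
import Literature.Analysis.FluidPDE.TurbWave0
import Literature.Analysis.FluidPDE.ZerothLaw
import HarnessLib

/-!
# Nonnegativity of long-time averages (`Literature.Turb` API for Wave0 / ZerothLaw)

Elementary sign facts about the long-time averages of `Literature.Analysis.FluidPDE.TurbWave0`
(`Turb.timeMean`, `Turb.longTimeAvgSup`) and the mean energy / mean dissipation of
`Literature.Analysis.FluidPDE.ZerothLaw` (`Turb.meanEnergy`, `Turb.meanDissipation`), *junk
values included*: a real `limsup` along a nontrivial filter of an eventually nonnegative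
function is nonnegative even when the function is unbounded (then `limsup = sInf ∅ = 0` in
`ℝ`), so `⟨g⟩ ≥ 0` for every pointwise nonnegative `g`, and in particular `⟨‖u‖₂²⟩ ≥ 0` and
`⟨ν‖∇u‖₂²⟩ ≥ 0` for `ν ≥ 0`. These are the lower bounds needed for squeeze arguments on
`meanDissipation` (e.g. in `Literature/Barriers/AnomalousDissipation/`), kept here so that
route files need not import a barrier file. All proofs are real; nothing is defined.

## References

* C. R. Doering, C. Foias, J. Fluid Mech. 467 (2002), §2 (the averages `⟨·⟩`).
-/

open MeasureTheory Set Filter Topology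
open scoped ENNReal NNReal

namespace Literature.Analysis.FluidPDE

/-- A real `limsup` along a nontrivial filter of an eventually nonnegative function is
nonnegative, junk value included: `limsup g l = sInf {a | ∀ᶠ i, g i ≤ a}` and every such `a`
dominates some `g i ≥ 0`, while `sInf ∅ = 0` in `ℝ` (Mathlib's `Real.sInf_nonneg` covers both
cases). [folklore] -/
theorem limsup_nonneg_of_eventually_nonneg {ι : Type*} {l : Filter ι} [l.NeBot] {g : ι → ℝ}
    (hg : ∀ᶠ i in l, 0 ≤ g i) : 0 ≤ limsup g l := by
  rw [Filter.limsup_eq]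
  refine Real.sInf_nonneg fun a ha => ?_
  obtain ⟨i, hi0, hia⟩ := (hg.and ha).exists
  exact hi0.trans hia

/-- The running time mean `T⁻¹ ∫₀ᵀ g` of a pointwise nonnegative function is nonnegative for
`T ≥ 0` (Doering–Foias 2002, §2). [cite: DoeringFoias2002, §2] -/
theorem timeMean_nonneg {g : ℝ → ℝ} (hg : ∀ t, 0 ≤ g t) {T : ℝ} (hT : 0 ≤ T) :
    0 ≤ timeMean g T := by
  unfold timeMean
  exact mul_nonneg (inv_nonneg.mpr hT) (intervalIntegral.integral_nonneg hT fun t _ => hg t)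

/-- The long-time average `⟨g⟩ = limsup_{T→∞} T⁻¹ ∫₀ᵀ g` of a pointwise nonnegative function is
nonnegative, junk values included (Doering–Foias 2002, §2). [cite: DoeringFoias2002, §2] -/
theorem longTimeAvgSup_nonneg {g : ℝ → ℝ} (hg : ∀ t, 0 ≤ g t) : 0 ≤ longTimeAvgSup g := by
  unfold longTimeAvgSup
  refine limsup_nonneg_of_eventually_nonneg ?_
  filter_upwards [eventually_ge_atTop (0 : ℝ)] with T hT
  exact timeMean_nonneg hg hT

variable {d : Type*} [Fintype d]

/-- The mean energy `⟨‖u‖₂²⟩` is nonnegative (Doering–Foias 2002, §2). [cite: DoeringFoias2002, §2] -/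
theorem meanEnergy_nonneg (u : ℝ → UnitAddTorus d → EuclideanSpace ℝ d) : 0 ≤ meanEnergy u :=
  longTimeAvgSup_nonneg fun _ => integral_nonneg fun _ => sq_nonneg _

/-- The mean dissipation `⟨ν‖∇u‖₂²⟩` (spectral gradient, `ENNReal.toReal`) is nonnegative for
`ν ≥ 0`, junk values included (Doering–Foias 2002, §2). [cite: DoeringFoias2002, §2] -/
theorem meanDissipation_nonneg {ν : ℝ} (hν : 0 ≤ ν)
    (u : ℝ → UnitAddTorus d → EuclideanSpace ℝ d) : 0 ≤ meanDissipation ν u :=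
  longTimeAvgSup_nonneg fun _ => mul_nonneg hν ENNReal.toReal_nonneg

end Literature.Analysis.FluidPDE
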